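import Mathlib
import Literature.AlgebraicGeometry.Resolution.QuadraticTransforms
import Summits.ResolutionOfSingularities.ResolutionOfSingularities.Theorems.RadicialJungCleanModelsCleanPatchingDefs
import HarnessLib

/-!
# Route `RadicialJung`, crux `CleanModels` (stmt-15917), stub `stub_cleanLU3Defect`, class (A) «arcs»: tools — exhaustion of a
# discrete rank-one valuation ring by quadratic transforms, transport of derivations, and the differential criterion for form (3)

Line `Sketch` rev 18 of crux stmt-ResolutionOfSingularities-15917, memo `Cruxes/CleanModels/Lines/Sketch-memo-defect-residue.md` §3; lead
`res-B-lead-1` g2.  OURS; nothing here proves resolution in characteristic `p`.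

* `exists_mem_of_quadraticTransforms_of_discrete` — **along a DISCRETE RANK-ONE valuation ring `O` (a value `v π` such that every
  value `< 1` is `≤ v π` and powers of `v π` go below any nonzero value) the sequence of quadratic transforms `R₀ → R₁ → ⋯` along `O` of a
  local ring `R₀` of `K` dominated by `O` EXHAUSTS `O`**: every `z ∈ O` lies in some `Rᵢ` (any dimension; Abhyankar's Lemma 12 is the
  dimension-two statement for all valuations).  Proof: `𝔪_{Rᵢ} ⊆ xᵢ R_{i+1}` for the exceptional parameter `xᵢ`, `v xᵢ ≤ v π`, so
  `z = a/b` improves to `(a/xᵢ)/(b/xᵢ)` and `v b` reaches `1` after finitely many steps.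
* `mul_derivation_mem_blowupRing`, `mul_derivation_mem_locAtCentre` — if a derivation `D` of `K` maps `R` into `R`, then `x · D` maps
  `R[𝔪/x]` into itself, and `s · D` preserves `locAtCentre B O` whenever it preserves `B` (the transported derivation `xⁿ D` on `Rₙ`).
* `looseCleanForm_three_of_derivation` — **differential criterion**: if `D` preserves the local ring `R`, `G ∈ 𝔪_R` and `D G` is a unit
  of `R`, then `G ∉ 𝔪_R²`, i.e. `G` has the loose clean form (3) (with `c = 0`).
-/

noncomputable section

set_option linter.dupNamespace false -- mandated namespace of this single-conjunct summit

open IsLocalRing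
open Literature.AlgebraicGeometry.Resolution

namespace Summit.ResolutionOfSingularities.ResolutionOfSingularities.Theorems.RadicialJung.CleanModels

variable {K : Type} [Field K]

/-! ## Exhaustion of a discrete rank-one valuation ring by quadratic transforms -/

/-- One step: along a quadratic transform `R → R₁` along `O`, a fraction `a/b` (`a, b ∈ R`, `b ≠ 0`, `v a ≤ v b < 1`) is the fraction
`(a/x)/(b/x)` of elements of `R₁` (`x` the exceptional parameter), and `v b ≤ v π · v (b/x)` when every value `< 1` is `≤ v π`.
[folklore] -/
theorem exists_div_step {O : ValuationSubring K} {R R₁ : Subring K} (h : IsQuadraticTransformAlong O R R₁)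
    (hdom : SubringDominates R O.toSubring) (π : K) (hπ : ∀ x : K, O.valuation x < 1 → O.valuation x ≤ O.valuation π)
    (a b : K) (ha : a ∈ R) (hb : b ∈ R) (hb0 : b ≠ 0) (hvb : O.valuation b < 1) (hab : O.valuation a ≤ O.valuation b) :
    ∃ a' b' : K, a' ∈ R₁ ∧ b' ∈ R₁ ∧ b' ≠ 0 ∧ a / b = a' / b' ∧ O.valuation a' ≤ O.valuation b' ∧
      O.valuation b ≤ O.valuation π * O.valuation b' := by
  obtain ⟨_, x, hxm, hx0, -, hR₁⟩ := h.exists_eq_locAtCentre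
  have hRO : R ≤ O.toSubring := hdom.1
  have hx0' : (x : K) ≠ 0 := fun h0 => hx0 (Subtype.ext h0)
  have hmem : ∀ y : K, y ∈ R → O.valuation y < 1 → y / (x : K) ∈ R₁ := by
    intro y hy hvy
    have hym : (⟨y, hy⟩ : R) ∈ maximalIdeal R := ((subringDominates_valuationSubring_iff hRO).mp hdom ⟨y, hy⟩).mpr hvy
    rw [hR₁]
    exact le_locAtCentre _ O (div_mem_blowupRing (x : K) hym)
  have hvx : O.valuation (x : K) < 1 := ((subringDominates_valuationSubring_iff hRO).mp hdom x).mp hxm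
  have hvxπ : O.valuation (x : K) ≤ O.valuation π := hπ _ hvx
  have hvx0 : 0 < O.valuation (x : K) := zero_lt_iff.mpr ((Valuation.ne_zero_iff _).mpr hx0')
  refine ⟨a / x, b / x, hmem a ha (lt_of_le_of_lt hab hvb), hmem b hb hvb, div_ne_zero hb0 hx0', ?_, ?_, ?_⟩
  · rw [div_div_div_cancel_right₀ hx0']
  · rw [map_div₀, map_div₀]
    exact div_le_div_of_nonneg_right hab hvx0.le |> fun h => (div_le_div_iff_of_pos_right hvx0).mpr hab
  · rw [map_div₀]
    calc O.valuation b = O.valuation (x : K) * (O.valuation b / O.valuation (x : K)) := by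
          rw [mul_div_cancel₀ _ hvx0.ne']
      _ ≤ O.valuation π * (O.valuation b / O.valuation (x : K)) := mul_le_mul_left hvxπ _

/-- **Exhaustion of a discrete rank-one valuation ring by quadratic transforms** (any dimension): if `O` is discrete of rank one —
some value `v π` bounds every value `< 1` from above and its powers go below every nonzero value — and `R₀ → R₁ → ⋯` is a sequence
of quadratic transforms along `O` of a local ring `R₀` of `K` dominated by `O`, then `O = ⋃ Rᵢ`. [folklore] -/
theorem exists_mem_of_quadraticTransforms_of_discrete (O : ValuationSubring K) (R : ℕ → Subring K)
    (hof : IsLocalRingOf (R 0)) (h0 : SubringDominates (R 0) O.toSubring)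
    (hstep : ∀ i, IsQuadraticTransformAlong O (R i) (R (i + 1)))
    (π : K) (hπ : ∀ x : K, O.valuation x < 1 → O.valuation x ≤ O.valuation π)
    (harch : ∀ x : K, x ≠ 0 → ∃ n : ℕ, O.valuation π ^ n ≤ O.valuation x)
    (z : K) (hz : z ∈ O) : ∃ i, z ∈ R i := by
  obtain ⟨a, ha, b, hb, hb0, rfl⟩ := hof.2 z
  have hab : O.valuation a ≤ O.valuation b := by
    have h1 : O.valuation (a / b) ≤ 1 := (O.valuation_le_one_iff _).mpr hz
    rw [map_div₀, div_le_one₀ (zero_lt_iff.mpr ((Valuation.ne_zero_iff _).mpr hb0))] at h1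
    exact h1
  obtain ⟨n, hn⟩ := harch b hb0
  -- induction on the number of steps `n`, uniformly in the stage and the fraction
  suffices key : ∀ (n i : ℕ) (a b : K), a ∈ R i → b ∈ R i → b ≠ 0 → O.valuation a ≤ O.valuation b →
      O.valuation π ^ n ≤ O.valuation b → ∃ j, a / b ∈ R j from key n 0 a b ha hb hb0 hab hn
  intro n
  induction n with
  | zero =>
    intro i a b ha hb hb0 hab hn
    have hdom := (sequence_dominates h0 hstep i).1
    rw [pow_zero] at hn
    -- `b` is a unit of `O`, hence of `R i`
    have hbinvO : b⁻¹ ∈ O := by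
      rw [← O.valuation_le_one_iff, map_inv₀]; exact inv_le_one_of_one_le₀ hn
    have hbinv : b⁻¹ ∈ R i := hdom.2 b hb hbinvO
    exact ⟨i, by rw [div_eq_mul_inv]; exact (R i).mul_mem ha hbinv⟩
  | succ m ih =>
    intro i a b ha hb hb0 hab hn
    have hdom := (sequence_dominates h0 hstep i).1
    by_cases hvb : O.valuation b < 1
    · obtain ⟨a', b', ha', hb', hb0', heq, hab', hvb'⟩ := exists_div_step (hstep i) hdom π hπ a b ha hb hb0 hvb hab
      have hπ0 : 0 < O.valuation π := by
        have h1 : O.valuation b ≤ O.valuation π := hπ b hvb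
        exact lt_of_lt_of_le (zero_lt_iff.mpr ((Valuation.ne_zero_iff _).mpr hb0)) h1
      have hn' : O.valuation π ^ m ≤ O.valuation b' := by
        rw [pow_succ'] at hn
        exact le_of_mul_le_mul_left (hn.trans hvb') hπ0
      obtain ⟨j, hj⟩ := ih (i + 1) a' b' ha' hb' hb0' hab' hn'
      exact ⟨j, heq ▸ hj⟩
    · -- `v b = 1`: unit
      have hvb1 : O.valuation b = 1 := le_antisymm ((O.valuation_le_one_iff _).mpr (hdom.1 hb)) (not_lt.mp hvb)
      have hbinvO : b⁻¹ ∈ O := by rw [← O.valuation_le_one_iff, map_inv₀, hvb1, inv_one]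
      have hbinv : b⁻¹ ∈ R i := hdom.2 b hb hbinvO
      exact ⟨i, by rw [div_eq_mul_inv]; exact (R i).mul_mem ha hbinv⟩

/-! ## Transport of derivations along quadratic transforms -/

/-- If a derivation `D` of `K` maps `R` into `R` and `x ∈ R`, then `x · D` maps the chart ring `R[𝔪/x]` into itself:
`x D(y/x) = D y - (y/x) D x`. [folklore] -/
theorem mul_derivation_mem_blowupRing (D : Derivation ℤ K K) {R : Subring K} [IsLocalRing R] (hD : ∀ y ∈ R, D y ∈ R)
    {x : K} (hx : x ∈ R) (hx0 : x ≠ 0) : ∀ y ∈ blowupRing R x, x * D y ∈ blowupRing R x := by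
  intro y hy
  induction hy using Subring.closure_induction with
  | mem y hy =>
    rcases hy with hy | ⟨z, hz, rfl⟩
    · exact (blowupRing R x).mul_mem (le_blowupRing R x hx) (le_blowupRing R x (hD y hy))
    · -- `x D(z/x) = D z - (z/x) D x`
      have h1 : x * D ((z : K) / x) = D (z : K) - (z : K) / x * D x := by
        rw [Derivation.leibniz_div]
        simp only [smul_eq_mul]
        field_simp
      rw [h1]
      exact (blowupRing R x).sub_mem (le_blowupRing R x (hD _ z.2))
        ((blowupRing R x).mul_mem (div_mem_blowupRing x hz) (le_blowupRing R x (hD x hx)))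
  | zero => rw [map_zero, mul_zero]; exact Subring.zero_mem _
  | one => rw [Derivation.map_one_eq_zero, mul_zero]; exact Subring.zero_mem _
  | add y z _ _ hy hz => rw [map_add, mul_add]; exact Subring.add_mem _ hy hz
  | neg y _ hy => rw [map_neg, mul_neg]; exact Subring.neg_mem _ hy
  | mul y z hy' hz' hy hz =>
    rw [Derivation.leibniz, smul_eq_mul, smul_eq_mul, mul_add, ← mul_assoc, ← mul_assoc, mul_comm x y, mul_comm x z, mul_assoc,
      mul_assoc]
    exact Subring.add_mem _ (Subring.mul_mem _ hy' hz) (Subring.mul_mem _ hz' hy)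

/-- If a derivation-like map `E` (here `s · D`) maps `B` into `B`, it maps `locAtCentre B O` into itself — for `E = s · D` with `D` a
derivation: `E(y/z) = (z E y - y E z)/z²` and `z` keeps value `1`. [folklore] -/
theorem mul_derivation_mem_locAtCentre (D : Derivation ℤ K K) (s : K) {B : Subring K} {O : ValuationSubring K}
    (hD : ∀ y ∈ B, s * D y ∈ B) : ∀ y ∈ locAtCentre B O, s * D y ∈ locAtCentre B O := by
  rintro _ ⟨y, hy, z, hz, hvz, rfl⟩
  have hz0 : z ≠ 0 := ne_zero_of_valuation_eq_one hvz
  refine ⟨z * (s * D y) - y * (s * D z), B.sub_mem (B.mul_mem hz (hD y hy)) (B.mul_mem hy (hD z hz)), z * z,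
    B.mul_mem hz hz, by rw [map_mul, hvz, one_mul], ?_⟩
  rw [Derivation.leibniz_div]
  simp only [smul_eq_mul]
  field_simp

/-! ## The differential criterion for the loose clean form (3) -/

/-- **Differential criterion.** If `s · D` maps the local ring `R ⊆ K` into itself and `s · D G` is a unit of `R`, then `G ∉ 𝔪_R²` —
since `s D (𝔪²) ⊆ 𝔪` — so a `G ∈ 𝔪_R` has the loose clean form (3) with `c = 0` (`looseCleanForm_three_of_not_mem_sq`). [folklore] -/
theorem not_mem_sq_of_derivation (D : Derivation ℤ K K) (s : K) {R : Subring K} [IsLocalRing R]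
    (hD : ∀ y ∈ R, s * D y ∈ R) (G : R)
    (hunit : ∃ hmem : s * D (G : K) ∈ R, IsUnit (⟨s * D (G : K), hmem⟩ : R)) : G ∉ maximalIdeal R ^ 2 := by
  classical
  obtain ⟨hmem, hu⟩ := hunit
  -- `s D` maps `𝔪²` into `𝔪`
  have key : ∀ y : R, y ∈ maximalIdeal R ^ 2 → (⟨s * D (y : K), hD _ y.2⟩ : R) ∈ maximalIdeal R := by
    intro y hy
    rw [pow_two] at hy
    refine Submodule.mul_induction_on hy (fun a ha b hb => ?_) (fun a b ha hb => ?_)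
    · -- `s D (a b) = a (s D b) + b (s D a) ∈ 𝔪`
      have h1 : (⟨s * D ((a * b : R) : K), hD _ (a * b).2⟩ : R) =
          a * ⟨s * D (b : K), hD _ b.2⟩ + b * ⟨s * D (a : K), hD _ a.2⟩ := by
        apply Subtype.ext
        change s * D ((a : K) * (b : K)) = (a : K) * (s * D (b : K)) + (b : K) * (s * D (a : K))
        rw [Derivation.leibniz, smul_eq_mul, smul_eq_mul]; ring
      rw [h1]
      exact (maximalIdeal R).add_mem ((maximalIdeal R).mul_mem_right _ ha) ((maximalIdeal R).mul_mem_right _ hb)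
    · have h1 : (⟨s * D ((a + b : R) : K), hD _ (a + b).2⟩ : R) = ⟨s * D (a : K), hD _ a.2⟩ + ⟨s * D (b : K), hD _ b.2⟩ := by
        apply Subtype.ext
        change s * D ((a : K) + (b : K)) = s * D (a : K) + s * D (b : K)
        rw [map_add, mul_add]
      rw [h1]
      exact (maximalIdeal R).add_mem ha hb
  intro hG2
  have h1 := key G hG2
  have h2 : (⟨s * D (G : K), hD _ G.2⟩ : R) = ⟨s * D (G : K), hmem⟩ := rfl
  rw [h2] at h1
  exact (IsLocalRing.mem_maximalIdeal _ |>.mp h1) hu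

/-- Form (3) from the criterion, packaged as `LooseCleanForm` through the inclusion `R ⊆ K` (with `c = 0`). [folklore] -/
theorem looseCleanForm_three_of_not_mem_sq {p : ℕ} (hp : p ≠ 0) {R : Subring K} [IsLocalRing R] (G : R)
    (hG : G ∈ maximalIdeal R) (hG2 : G ∉ maximalIdeal R ^ 2) : LooseCleanForm p R.subtype (G : K) := by
  refine Or.inr (Or.inr ⟨G, 0, rfl, ?_, ?_⟩)
  · rw [zero_pow hp, sub_zero]; exact hG
  · rw [zero_pow hp, sub_zero]; exact hG2

end Summit.ResolutionOfSingularities.ResolutionOfSingularities.Theorems.RadicialJung.CleanModels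

end
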